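import Summits.Ventures.PercRepro.RankLevelSetPerElemCircuit

/-! # RankLevelSetPerElemChainTriple — THE REFINED UP-SHADOW CHAIN: THE PER-CIRCUIT INEQUALITY OF (★★) FOR EVERY
CIRCUIT WITH `#K + 2 ≥ j` WHEN THE COMPLEMENT OF THE CIRCUIT HAS NO PARALLEL TRIPLE OF THE DUAL (night-1 g37;
dossier §49; on `RankLevelSetPerElemCircuit`)

The up-shadow step of `RankLevelSetPerElemChain` loses the factor `ρ − 1` for the coloops of a spanning set of
the hyperplane `H` of the dual; the bound `#coloops ≤ ρ − 1` is attained only when the non-coloops form a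
single parallel class of `M✶ | H` of at least `#Y − ρ + 1` elements. Along the chain of the per-circuit
inequality of (★★) at level `j` every such set has `≥ j + 1` elements, so the extremal case needs THREE
pairwise parallel elements of `M✶` inside `H`, i.e. a SERIES TRIPLE of `M` (three elements any two of which
form a cocircuit) disjoint from the circuit. Without such a triple the step improves to
`(h − i − (ρ − 2)) · f i ≤ (i + 1) · f (i + 1)` (**`ncard_coloops_add_two_le`**, **`absorbFam_step_of_bound`**,
**`absorbFam_step_of_no_triple`**), and the telescoped chain closes as soon as `#K + 2 ≥ j`
(**`perCircuit_le_of_no_triple`**) — one more than `perCircuit_le`. Every declaration has a docstring; imports: the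
cell's own modules and Mathlib only. Axioms: standard. -/

namespace PercRepro

open Set Matroid

variable {α : Type}

/-! ## The refined coloop bound -/

/-- **A set `Y` of nonloops of rank `≤ ρ` with more than `ρ + 1` elements and no three pairwise parallel elements
has at most `ρ − 2` coloops**: the non-coloops `Y'` have `≥ 3` elements, and if they had rank `1` they would be
pairwise parallel. -/
lemma ncard_coloops_add_two_le {N : Matroid α} [N.Finite] {Y : Set α} (hYE : Y ⊆ N.E)
    (hnl : ∀ e ∈ Y, N.IsNonloop e)
    (hnt : ∀ p ∈ Y, ∀ q ∈ Y, ∀ r ∈ Y, p ≠ q → p ≠ r → q ≠ r → q ∈ N.closure {p} → r ∉ N.closure {p})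
    {ρ : ℕ} (hρ : N.eRk Y ≤ ρ) (hY : ρ + 1 < Y.ncard) :
    {t ∈ Y | t ∉ N.closure (Y \ {t})}.ncard + 2 ≤ ρ := by
  classical
  set C := {t ∈ Y | t ∉ N.closure (Y \ {t})} with hC
  have hYfin : Y.Finite := N.ground_finite.subset hYE
  have hCY : C ⊆ Y := fun t ht => ht.1
  have hCfin : C.Finite := hYfin.subset hCY
  set Y' := Y \ C with hY'
  have hsplit : Y = Y' ∪ ↑hCfin.toFinset := by
    rw [hCfin.coe_toFinset, Set.sdiff_union_of_subset hCY]
  have hsk : ∀ d ∈ hCfin.toFinset, d ∉ N.closure (Y' ∪ (↑hCfin.toFinset \ {d})) := by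
    intro d hd
    rw [hCfin.mem_toFinset] at hd
    intro h
    apply hd.2
    refine N.closure_subset_closure ?_ h
    rw [hCfin.coe_toFinset]
    intro x hx
    rcases hx with hx | hx
    · exact ⟨hx.1, fun h => hx.2 (by rw [Set.mem_singleton_iff] at h; rw [h]; exact hd)⟩
    · exact ⟨hCY hx.1, hx.2⟩
  have hrk : N.eRk Y = N.eRk Y' + (hCfin.toFinset.card : ℕ∞) := by
    rw [hsplit] at hρ ⊢
    exact eRk_union_eq_add_encard_of_forall_notMem_closure hCfin.toFinset
      (by rw [hCfin.coe_toFinset]; exact hCY.trans hYE) hsk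
  have hCcard : hCfin.toFinset.card = C.ncard := (Set.ncard_eq_toFinset_card C hCfin).symm
  -- the old bound `#C + 1 ≤ ρ`, hence `#Y' ≥ 3`
  have hold : C.ncard + 1 ≤ ρ := ncard_coloops_add_one_le hYE hnl hρ (by omega)
  have hY'card : Y'.ncard = Y.ncard - C.ncard := Set.ncard_sdiff hCY hCfin
  have hY'3 : 2 < Y'.ncard := by omega
  have hY'fin : Y'.Finite := hYfin.subset Set.sdiff_subset
  have hY'E : Y' ⊆ N.E := Set.sdiff_subset.trans hYE
  -- the rank of `Y'` is at least `2`
  have h2 : (2 : ℕ∞) ≤ N.eRk Y' := by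
    by_contra hlt
    have hlt2 : N.eRk Y' < 2 := not_le.mp hlt
    rw [← one_add_one_eq_two] at hlt2
    have hle1 : N.eRk Y' ≤ 1 := Order.le_of_lt_add_one hlt2
    obtain ⟨u, hu⟩ : Y'.Nonempty := by
      rw [← Set.ncard_pos hY'fin]; omega
    have h1 : (1 : ℕ∞) ≤ N.eRk Y' := by
      rw [← (hnl u hu.1).eRk_eq]
      exact N.eRk_mono (Set.singleton_subset_iff.mpr hu)
    have heq : N.eRk Y' = 1 := le_antisymm hle1 h1
    obtain ⟨e, heY', -, hsub⟩ := (Matroid.eRk_eq_one_iff hY'E).mp heq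
    -- two further elements of `Y'` are both in `cl {e}`
    have hrest : 1 < (Y' \ {e}).ncard := by
      rw [Set.ncard_sdiff_singleton_of_mem heY']; omega
    obtain ⟨q, r, hq, hr, hqr⟩ := (Set.one_lt_ncard_iff (hY'fin.subset Set.sdiff_subset)).mp hrest
    have hqe : q ≠ e := by simpa using hq.2
    have hre : r ≠ e := by simpa using hr.2
    exact hnt e heY'.1 q hq.1.1 r hr.1.1 hqe.symm hre.symm hqr (hsub hq.1) (hsub hr.1)
  have h3 : ((C.ncard + 2 : ℕ) : ℕ∞) ≤ ρ := by
    calc ((C.ncard + 2 : ℕ) : ℕ∞) = (hCfin.toFinset.card : ℕ∞) + 2 := by rw [hCcard]; push_cast; ring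
      _ ≤ (hCfin.toFinset.card : ℕ∞) + N.eRk Y' := by gcongr
      _ = N.eRk Y := by rw [hrk, add_comm]
      _ ≤ ρ := hρ
  exact_mod_cast h3

/-! ## The up-shadow step with an abstract coloop bound -/

/-- **THE UP-SHADOW STEP WITH A COLOOP BOUND `c₀`**: if every spanning complement `H ∖ X` of a member `X` at level
`i` has at most `c₀` coloops, then `(#H − i − c₀) · f i ≤ (i + 1) · f (i + 1)` (the proof of `absorbFam_step` with
the bound abstracted). -/
theorem absorbFam_step_of_bound {N : Matroid α} [N.Finite] {H S : Set α} {y : α} (hHE : H ⊆ N.E) (hSE : S ⊆ N.E)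
    (hyE : y ∈ N.E) (hyH : y ∉ N.closure H) (hHy : N.Spanning (insert y H)) {i c₀ : ℕ}
    (hbound : ∀ X ⊆ H, X.ncard = i → N.closure (H \ X) = N.closure H →
      {t ∈ H \ X | t ∉ N.closure ((H \ X) \ {t})}.ncard ≤ c₀) :
    (H.ncard - i - c₀) *
        {X | X ⊆ H ∧ X.ncard = i ∧ N.Spanning (S ∪ X) ∧ N.Spanning (insert y (H \ X))}.ncard ≤
      (i + 1) * {X | X ⊆ H ∧ X.ncard = i + 1 ∧ N.Spanning (S ∪ X) ∧ N.Spanning (insert y (H \ X))}.ncard := by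
  classical
  have hHfin : H.Finite := N.ground_finite.subset hHE
  have hAfin := absorbFam_finite (S := S) hHE y i
  have hBfin := absorbFam_finite (S := S) hHE y (i + 1)
  have hiff : ∀ X ⊆ H, (N.Spanning (insert y X) ↔ N.closure X = N.closure H) :=
    fun X hX => spanning_insert_iff_closure_eq hHE hyE hyH hHy hX
  set I : Finset (Set α × Set α) := (hAfin.toFinset ×ˢ hBfin.toFinset).filter (fun p => p.1 ⊆ p.2) with hI
  -- LOWER BOUND: every member at level `i` has at least `#H − i − c₀` up-neighbours
  have hlow : (H.ncard - i - c₀) * hAfin.toFinset.card ≤ I.card := by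
    refine Finset.mul_card_image_le_card_of_maps_to (f := Prod.fst) ?_ _ ?_
    · intro p hp
      rw [hI, Finset.mem_filter, Finset.mem_product] at hp
      exact hp.1.1
    · intro X hX
      have hXA := hAfin.mem_toFinset.mp hX
      obtain ⟨hXH, hXi, hXs, hXy⟩ := hXA
      have hXfin : X.Finite := hHfin.subset hXH
      set Y := H \ X with hY
      have hYE : Y ⊆ N.E := Set.sdiff_subset.trans hHE
      have hYfin : Y.Finite := hHfin.subset Set.sdiff_subset
      have hYcard : Y.ncard = H.ncard - i := by rw [hY, Set.ncard_sdiff hXH hXfin, hXi]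
      have hYcl : N.closure Y = N.closure H := (hiff Y Set.sdiff_subset).mp hXy
      have hcol : {t ∈ Y | t ∉ N.closure (Y \ {t})}.ncard ≤ c₀ := hbound X hXH hXi hYcl
      have hmaps : ∀ t ∈ Y \ {t ∈ Y | t ∉ N.closure (Y \ {t})},
          (X, insert t X) ∈ I.filter (fun p => p.1 = X) := by
        intro t ht
        have htY : t ∈ Y := ht.1
        have htcl : t ∈ N.closure (Y \ {t}) := by
          by_contra h
          exact ht.2 ⟨htY, h⟩
        rw [Finset.mem_filter, hI, Finset.mem_filter, Finset.mem_product]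
        refine ⟨⟨⟨hX, ?_⟩, Set.subset_insert t X⟩, rfl⟩
        rw [hBfin.mem_toFinset]
        refine ⟨Set.insert_subset htY.1 hXH, ?_, ?_, ?_⟩
        · rw [Set.ncard_insert_of_notMem htY.2 hXfin, hXi]
        · exact hXs.superset (Set.union_subset_union_right S (Set.subset_insert t X))
            (Set.union_subset hSE (Set.insert_subset (hHE htY.1) (hXH.trans hHE)))
        · have heq : H \ insert t X = Y \ {t} := by
            ext x
            simp only [hY, Set.mem_sdiff, Set.mem_insert_iff, Set.mem_singleton_iff, not_or]
            tauto
          rw [heq, hiff _ (Set.sdiff_subset.trans Set.sdiff_subset)]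
          rw [← hYcl]
          refine subset_antisymm (N.closure_subset_closure Set.sdiff_subset) ?_
          refine Matroid.closure_subset_closure_of_subset_closure ?_
          intro x hx
          by_cases hxt : x = t
          · rw [hxt]; exact htcl
          · exact N.subset_closure _ (Set.sdiff_subset.trans hYE) ⟨hx, by simpa using hxt⟩
      have hinj : Set.InjOn (fun t => (X, insert t X)) (Y \ {t ∈ Y | t ∉ N.closure (Y \ {t})}) := by
        intro t₁ ht₁ t₂ ht₂ heq
        have h : insert t₁ X = insert t₂ X := congrArg Prod.snd heq
        have : t₁ ∈ insert t₂ X := h ▸ Set.mem_insert t₁ X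
        rcases this with h' | h'
        · exact h'
        · exact absurd h' ht₁.1.2
      have hcard1 : (Y \ {t ∈ Y | t ∉ N.closure (Y \ {t})}).ncard =
          Y.ncard - {t ∈ Y | t ∉ N.closure (Y \ {t})}.ncard :=
        Set.ncard_sdiff (fun t ht => ht.1) (hYfin.subset (fun t ht => ht.1))
      calc H.ncard - i - c₀ ≤ (Y \ {t ∈ Y | t ∉ N.closure (Y \ {t})}).ncard := by
            rw [hcard1, hYcard]; omega
        _ = ((fun t => (X, insert t X)) '' (Y \ {t ∈ Y | t ∉ N.closure (Y \ {t})})).ncard :=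
            hinj.ncard_image.symm
        _ ≤ (I.filter (fun p => p.1 = X)).card := by
            rw [← Set.ncard_coe_finset]
            refine Set.ncard_le_ncard ?_ (Finset.finite_toSet _)
            rintro p ⟨t, ht, rfl⟩
            exact hmaps t ht
  -- UPPER BOUND: every member at level `i + 1` has at most `i + 1` down-neighbours
  have hup : I.card ≤ (i + 1) * hBfin.toFinset.card := by
    refine Finset.card_le_mul_card_image_of_maps_to (f := Prod.snd) ?_ _ ?_
    · intro p hp
      rw [hI, Finset.mem_filter, Finset.mem_product] at hp
      exact hp.1.2
    · intro X' hX'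
      have hX'B := hBfin.mem_toFinset.mp hX'
      have hX'fin : X'.Finite := hHfin.subset hX'B.1
      have hex : ∀ p ∈ I.filter (fun p => p.2 = X'), ∃ t ∈ X', p.1 = X' \ {t} := by
        intro p hp
        rw [Finset.mem_filter, hI, Finset.mem_filter, Finset.mem_product] at hp
        obtain ⟨⟨⟨hpA, -⟩, hsub⟩, hp2⟩ := hp
        rw [hp2] at hsub
        have hpA' := hAfin.mem_toFinset.mp hpA
        have h1 : (X' \ p.1).ncard = 1 := by
          rw [Set.ncard_sdiff hsub (hHfin.subset hpA'.1), hX'B.2.1, hpA'.2.1]; omega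
        obtain ⟨t, ht⟩ := Set.ncard_eq_one.mp h1
        have htX' : t ∈ X' \ p.1 := by rw [ht]; exact Set.mem_singleton t
        refine ⟨t, htX'.1, ?_⟩
        ext x
        constructor
        · intro hx
          exact ⟨hsub hx, fun h => htX'.2 (by rw [Set.mem_singleton_iff] at h; rw [← h]; exact hx)⟩
        · intro hx
          by_contra hxp
          have : x ∈ X' \ p.1 := ⟨hx.1, hxp⟩
          rw [ht, Set.mem_singleton_iff] at this
          exact hx.2 (by rw [this]; exact Set.mem_singleton t)
      choose g hg using hex
      set g' : Set α × Set α → α := fun p => if h : p ∈ I.filter (fun p => p.2 = X') then g p h else y with hg'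
      have hg'eq : ∀ p (hp : p ∈ I.filter (fun p => p.2 = X')), g' p = g p hp := by
        intro p hp
        simp only [hg', dif_pos hp]
      calc (I.filter (fun p => p.2 = X')).card ≤ hX'fin.toFinset.card := by
            refine Finset.card_le_card_of_injOn g' ?_ ?_
            · intro p hp
              rw [Finset.mem_coe] at hp
              rw [Finset.mem_coe, hX'fin.mem_toFinset, hg'eq p hp]
              exact (hg p hp).1
            · intro p hp q hq heq
              rw [Finset.mem_coe] at hp hq
              rw [hg'eq p hp, hg'eq q hq] at heq
              have hp' := Finset.mem_filter.mp hp
              have hq' := Finset.mem_filter.mp hq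
              refine Prod.ext ?_ (hp'.2.trans hq'.2.symm)
              rw [(hg p hp).2, (hg q hq).2, heq]
        _ = i + 1 := by rw [← Set.ncard_eq_toFinset_card X' hX'fin, hX'B.2.1]
  rw [Set.ncard_eq_toFinset_card _ hAfin, Set.ncard_eq_toFinset_card _ hBfin]
  exact hlow.trans hup

/-- **THE REFINED UP-SHADOW STEP**: for `H ⊆ N.E` of nonloops with `rk H ≤ ρ`, no three pairwise parallel elements
of `N` inside `H`, `y ∉ cl H`, `insert y H` spanning, and a level `i` with `i + ρ + 1 < #H`:
`(#H − i − (ρ − 2)) · f i ≤ (i + 1) · f (i + 1)`. -/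
theorem absorbFam_step_of_no_triple {N : Matroid α} [N.Finite] {H S : Set α} {y : α} (hHE : H ⊆ N.E)
    (hSE : S ⊆ N.E) (hyE : y ∈ N.E) (hyH : y ∉ N.closure H) (hHy : N.Spanning (insert y H))
    (hnl : ∀ e ∈ H, N.IsNonloop e)
    (hnt : ∀ p ∈ H, ∀ q ∈ H, ∀ r ∈ H, p ≠ q → p ≠ r → q ≠ r → q ∈ N.closure {p} → r ∉ N.closure {p})
    {ρ : ℕ} (hρ : N.eRk H ≤ ρ) {i : ℕ} (hi : i + ρ + 1 < H.ncard) :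
    (H.ncard - i - (ρ - 2)) *
        {X | X ⊆ H ∧ X.ncard = i ∧ N.Spanning (S ∪ X) ∧ N.Spanning (insert y (H \ X))}.ncard ≤
      (i + 1) * {X | X ⊆ H ∧ X.ncard = i + 1 ∧ N.Spanning (S ∪ X) ∧ N.Spanning (insert y (H \ X))}.ncard := by
  refine absorbFam_step_of_bound hHE hSE hyE hyH hHy ?_
  intro X hXH hXi hYcl
  have hHfin : H.Finite := N.ground_finite.subset hHE
  have hYE : H \ X ⊆ N.E := Set.sdiff_subset.trans hHE
  have hYcard : (H \ X).ncard = H.ncard - i := by rw [Set.ncard_sdiff hXH (hHfin.subset hXH), hXi]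
  have hYρ : N.eRk (H \ X) ≤ ρ := (N.eRk_mono Set.sdiff_subset).trans hρ
  have h := ncard_coloops_add_two_le hYE (fun e he => hnl e he.1)
    (fun p hp q hq r hr hpq hpr hqr hq' => hnt p hp.1 q hq.1 r hr.1 hpq hpr hqr hq') hYρ (by omega)
  omega

/-! ## The per-circuit inequality with the refined chain -/

/-- **THE PER-CIRCUIT INEQUALITY OF (★★) AT LEVEL `j` BY THE REFINED CHAIN** (coloop-free `M`, `y ∈ E`, `3 ≤ j`,
`2j + 1 < #E`): for an absorbing `j`-set `Z₀` whose circuit `K = C_y(Z₀)` has `#K + 2 ≥ j` elements and whose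
complement `E ∖ K` contains no three pairwise parallel elements of `M✶` (no series triple of `M`), the members of
`K` at level `j` are at most the targets of `K` at level `j + 1`. -/
theorem perCircuit_le_of_no_triple (M : Matroid α) [M.Finite] (hcol : ∀ e, ¬ M.IsColoop e) {y : α} (hy : y ∈ M.E)
    {j : ℕ} (hj : 3 ≤ j) (hn : 2 * j + 1 < M.E.ncard) {Z₀ : Set α} (hZ₀ : Z₀ ∈ lowAbsorbAt M y j)
    (hnt : ∀ p ∈ M.E \ M.fundCircuit y Z₀, ∀ q ∈ M.E \ M.fundCircuit y Z₀, ∀ r ∈ M.E \ M.fundCircuit y Z₀,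
      p ≠ q → p ≠ r → q ≠ r → q ∈ M✶.closure {p} → r ∉ M✶.closure {p})
    (hK : j ≤ (M.fundCircuit y Z₀).ncard + 2) :
    {Z ∈ lowAbsorbAt M y j | M.fundCircuit y Z = M.fundCircuit y Z₀}.ncard ≤
      {Q ∈ biIndep M (j + 1) | y ∈ Q ∧ ¬ M.Indep (insert y (M.E \ Q)) ∧
        M.fundCircuit y (M.E \ Q) = M.fundCircuit y Z₀}.ncard := by
  obtain ⟨hKeq, hSZ, hSE, hHE, -, -, hHy, hyH, hnl, hrk⟩ := circuit_dual_facts M hcol hy hZ₀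
  have h1 := members_le_fam M hy hZ₀
  have h2 := fam_le_targets M hy (by omega) hZ₀
  have hZE : Z₀ ⊆ M.E := hZ₀.1.1
  have hZj : Z₀.ncard = j := hZ₀.1.2.1
  set K := M.fundCircuit y Z₀ with hK'
  set S := K \ {y} with hS
  set H := M.E \ K with hH
  have hyK : y ∈ K := M.mem_fundCircuit y Z₀
  have hKE : K ⊆ M.E := hKeq ▸ Set.insert_subset hy hSE
  have hKfin : K.Finite := M.ground_finite.subset hKE
  have hKcard : K.ncard = S.ncard + 1 := by
    rw [hS, Set.ncard_sdiff_singleton_of_mem hyK]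
    have : 1 ≤ K.ncard := (Set.ncard_pos hKfin).mpr ⟨y, hyK⟩
    omega
  have hKle : K.ncard ≤ M.E.ncard := Set.ncard_le_ncard hKE M.ground_finite
  have hHcard : H.ncard + K.ncard = M.E.ncard := by
    rw [hH, Set.ncard_sdiff hKE hKfin]; omega
  have hsj : S.ncard ≤ j := by
    rw [← hZj]; exact Set.ncard_le_ncard hSZ (M.ground_finite.subset hZE)
  have hyE' : y ∈ M✶.E := by rwa [Matroid.dual_ground]
  have hHE' : H ⊆ M✶.E := by rwa [Matroid.dual_ground]
  have hSE' : S ⊆ M✶.E := by rwa [Matroid.dual_ground]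
  -- the rank of `H` in the dual is at most `j − 1`
  have hρ : M✶.eRk H ≤ ((j - 1 : ℕ) : ℕ∞) := by
    have h : M✶.eRk H + 1 ≤ ((j - 1 : ℕ) : ℕ∞) + 1 := by
      rw [show ((j - 1 : ℕ) : ℕ∞) + 1 = ((j : ℕ) : ℕ∞) by norm_cast; omega]
      exact hrk
    exact (WithTop.add_le_add_iff_right (by decide)).mp h
  -- the refined chain from level `j − s` to level `h − j`
  set f : ℕ → ℕ := fun i =>
    {X | X ⊆ H ∧ X.ncard = i ∧ M✶.Spanning (S ∪ X) ∧ M✶.Spanning (insert y (H \ X))}.ncard with hf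
  have hchain : f (j - S.ncard) ≤ f (H.ncard - j) := by
    have hm : H.ncard - j = (j - S.ncard) + ((H.ncard + S.ncard) - 2 * j) := by omega
    rw [hm]
    refine le_of_chain f (c := H.ncard - j + 3 - (j - S.ncard)) (by omega) ?_
    intro t ht
    have hstep := absorbFam_step_of_no_triple (S := S) hHE' hSE' hyE' hyH hHy hnl hnt hρ
      (i := j - S.ncard + t) (by omega)
    have e1 : H.ncard - (j - S.ncard + t) - (j - 1 - 2) = H.ncard - j + 3 - (j - S.ncard) - t := by omega
    rw [e1] at hstep
    exact hstep
  calc {Z ∈ lowAbsorbAt M y j | M.fundCircuit y Z = M.fundCircuit y Z₀}.ncard ≤ f (j - S.ncard) := h1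
    _ ≤ f (H.ncard - j) := hchain
    _ ≤ _ := h2


end PercRepro
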